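import Mathlib
import Literature.RingTheory.MvPowerSeries.OptionEquivLeft
import Literature.RingTheory.PowerSeries.LinearIndependenceBaseChange
import HarnessLib

/-!
# Linear independence of products `∏_s f_{i_s}(x_s)` over `K(p(x₁), …, p(x_d))` (CDT §2.1)

`Literature/RingTheory/MvPowerSeries/ProductFamilyIndependence.lean`. Everything here is PROVED
(no definition, no named fact). F. Calegari, V. Dimitrov, Y. Tang, *The unbounded denominators
conjecture* (J. Amer. Math. Soc. **38** (2025), 627–702; arXiv:2109.09040), §2.1, end of the proof
of Lemma 2.1.1: "Since the formal functions `f₁, …, f_m ∈ ℚ⟦x⟧` are linearly independent over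
`ℚ(p(x))`, an easy induction argument on the dimension `d` shows that `{f_𝐢}_{𝐢 ∈ {1,…,m}^d}` are
linearly independent over `ℚ(p(𝐱))`." Here `f_𝐢(𝐱) = ∏_{s} f_{i_s}(x_s)` and
`p(𝐱) = (p(x₁), …, p(x_d))`. We prove the polynomial-coefficient form (equivalent after clearing
denominators): if no nontrivial relation `∑_i Q_i(p) f_i = 0`, `Q_i ∈ K[X]`, holds in `K⟦y⟧`, then
no nontrivial relation `∑_𝐢 Q_𝐢(p(x₁), …, p(x_d)) · ∏_s f_{𝐢 s}(x_s) = 0` with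
`Q_𝐢 ∈ K[X₁, …, X_d]` holds in `K⟦x₁, …, x_d⟧` (`productFamily_independent_fin`). The induction
step (`productFamily_independent_option`) splits off one variable with
`Literature.RingTheory.MvPowerSeries.optionEquivLeft` and applies the extension-of-scalars lemma
`Literature.RingTheory.PowerSeries.linearIndependent_aeval_baseChange` over the coefficient ring
`K⟦x_σ⟧`; our proof of the step is this algebraic one rather than the specialisation
`x_{d+1} := c` of the source.

## References

* [CalegariDimitrovTang2025] F. Calegari, V. Dimitrov, Y. Tang, The unbounded denominators
  conjecture, J. Amer. Math. Soc. 38 (2025), no. 3, 627–702, §2.1, end of the proof of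
  Lemma 2.1.1; arXiv:2109.09040.
-/

noncomputable section

open Finset MvPowerSeries

namespace Literature.RingTheory.MvPowerSeries

variable {K : Type*} [Field K] {ι : Type*} [Fintype ι]

/-! ### 1. The transfer homomorphism `K[X_{Option σ}] → K⟦x_σ⟧[X]` -/

section step

variable {σ : Type*} [Fintype σ] [DecidableEq σ] (p : PowerSeries K)

omit [Fintype σ] in
/-- The `K`-algebra map `ψ : K[X_{Option σ}] → (K⟦x_σ⟧)[X]` sending `X_none ↦ X` and
`X_{some s} ↦ C(p(x_s))`. Under `optionEquivLeft`, evaluating a polynomial at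
`(p(x_o))_{o ∈ Option σ}` becomes evaluating `ψ` of it at `X := p` (with constant coefficients).
[folklore] -/
theorem optionEquivLeft_aeval (Q : MvPolynomial (Option σ) K) :
    optionEquivLeft (MvPolynomial.aeval
        (fun o : Option σ ↦ (p.toMvPowerSeries o : MvPowerSeries (Option σ) K)) Q) =
      Polynomial.aeval (PowerSeries.map (MvPowerSeries.C (σ := σ) (R := K)) p)
        (MvPolynomial.aeval (fun o : Option σ ↦ Option.elim o Polynomial.X
          (fun s ↦ Polynomial.C (p.toMvPowerSeries s : MvPowerSeries σ K))) Q) := by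
  induction Q using MvPolynomial.induction_on with
  | C r =>
    rw [MvPolynomial.aeval_C, MvPolynomial.aeval_C, Polynomial.algebraMap_apply, Polynomial.aeval_C]
    change optionEquivLeft (MvPowerSeries.C r) = PowerSeries.C (MvPowerSeries.C r)
    exact optionEquivLeft_C r
  | add P Q hP hQ => rw [map_add, map_add, map_add, map_add, hP, hQ]
  | mul_X P o hP =>
    rw [map_mul, map_mul, map_mul, map_mul, hP, MvPolynomial.aeval_X, MvPolynomial.aeval_X]
    congr 1
    cases o with
    | none =>
      rw [Option.elim_none, Polynomial.aeval_X]
      exact optionEquivLeft_toMvPowerSeries_none p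
    | some s =>
      rw [Option.elim_some, Polynomial.aeval_C]
      exact optionEquivLeft_toMvPowerSeries_some p s

omit [Fintype σ] [DecidableEq σ] in
/-- Coefficients of `ψ Q`: `[X^k] ψ(Q) = ([X_none^k] Q)(p(x_s))_s`, where `[X_none^k] Q` is the
`k`-th coefficient of `Q` viewed in `(K[X_σ])[X_none]` via `MvPolynomial.optionEquivLeft`.
[folklore] -/
theorem coeff_aeval_optionElim (Q : MvPolynomial (Option σ) K) (k : ℕ) :
    (MvPolynomial.aeval (fun o : Option σ ↦ Option.elim o Polynomial.X
        (fun s ↦ Polynomial.C (p.toMvPowerSeries s : MvPowerSeries σ K))) Q).coeff k =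
      MvPolynomial.aeval (fun s : σ ↦ (p.toMvPowerSeries s : MvPowerSeries σ K))
        ((MvPolynomial.optionEquivLeft K σ Q).coeff k) := by
  -- both sides of `ψ = map (aeval) ∘ optionEquivLeft` agree on generators
  suffices h : MvPolynomial.aeval (fun o : Option σ ↦ Option.elim o Polynomial.X
        (fun s ↦ Polynomial.C (p.toMvPowerSeries s : MvPowerSeries σ K))) Q =
      Polynomial.map (MvPolynomial.aeval (R := K)
        (fun s : σ ↦ (p.toMvPowerSeries s : MvPowerSeries σ K))).toRingHom
        (MvPolynomial.optionEquivLeft K σ Q) by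
    rw [h, Polynomial.coeff_map]; rfl
  induction Q using MvPolynomial.induction_on with
  | C r =>
    rw [MvPolynomial.aeval_C, MvPolynomial.optionEquivLeft_C, Polynomial.map_C,
      Polynomial.algebraMap_apply]
    congr 1
    change MvPowerSeries.C r = MvPolynomial.aeval _ (MvPolynomial.C r)
    rw [MvPolynomial.aeval_C]; rfl
  | add P Q hP hQ => rw [map_add, map_add, Polynomial.map_add, hP, hQ]
  | mul_X P o hP =>
    rw [map_mul, map_mul, Polynomial.map_mul, hP, MvPolynomial.aeval_X]
    congr 1
    cases o with
    | none => rw [Option.elim_none, MvPolynomial.optionEquivLeft_X_none, Polynomial.map_X]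
    | some s =>
      rw [Option.elim_some, MvPolynomial.optionEquivLeft_X_some, Polynomial.map_C]
      congr 1
      change _ = MvPolynomial.aeval _ (MvPolynomial.X s)
      rw [MvPolynomial.aeval_X]

end step

/-! ### 2. The induction step: from `σ` variables to `Option σ` variables -/

section optionStep

variable {σ : Type*} [Fintype σ] [DecidableEq σ]

/-- **Induction step** (one more variable): if `f : ι → K⟦T⟧`, `p ∈ K⟦T⟧` admit no nontrivial
`K[X]`-relation `∑ Q_i(p) f_i = 0`, and the products `∏_s f_{𝐣 s}(x_s)`, `𝐣 : σ → ι`, admit no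
nontrivial relation with coefficients `Q_𝐣(p(x_s))_s`, `Q_𝐣 ∈ K[X_σ]`, then the same holds in the
variables `Option σ`. [cite: CalegariDimitrovTang2025, §2.1, end of the proof of Lemma 2.1.1] -/
theorem productFamily_independent_option (f : ι → PowerSeries K) (p : PowerSeries K)
    (hind : ∀ Q : ι → Polynomial K, ∑ i, Polynomial.aeval p (Q i) * f i = 0 → ∀ i, Q i = 0)
    (IH : ∀ Q : (σ → ι) → MvPolynomial σ K,
      ∑ J : σ → ι, MvPolynomial.aeval (fun s : σ ↦ (p.toMvPowerSeries s : MvPowerSeries σ K))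
        (Q J) * ∏ s, ((f (J s)).toMvPowerSeries s : MvPowerSeries σ K) = 0 → ∀ J, Q J = 0)
    (Q : (Option σ → ι) → MvPolynomial (Option σ) K)
    (hrel : ∑ I : Option σ → ι,
      MvPolynomial.aeval (fun o : Option σ ↦ (p.toMvPowerSeries o : MvPowerSeries (Option σ) K))
        (Q I) * ∏ o, ((f (I o)).toMvPowerSeries o : MvPowerSeries (Option σ) K) = 0) :
    ∀ I, Q I = 0 := by
  classical
  -- abbreviations (kept transparent: we only use them through the defining equations)
  set B := MvPowerSeries σ K with hB
  set ψ : MvPolynomial (Option σ) K →ₐ[K] Polynomial B := MvPolynomial.aeval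
    (fun o : Option σ ↦ Option.elim o Polynomial.X
      (fun s ↦ Polynomial.C (p.toMvPowerSeries s : MvPowerSeries σ K))) with hψ
  set b : PowerSeries B := PowerSeries.map (algebraMap K B) p with hb
  set G : (σ → ι) → B := fun J ↦ ∏ s, ((f (J s)).toMvPowerSeries s : MvPowerSeries σ K) with hG
  set e : (Option σ → ι) ≃ ι × (σ → ι) := Equiv.piOptionEquivProd with he
  have hCalg : (MvPowerSeries.C (σ := σ) (R := K)) = algebraMap K B := MvPowerSeries.c_eq_algebraMap
  -- (1) transport the relation along `optionEquivLeft`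
  have hprod : ∀ I : Option σ → ι,
      optionEquivLeft (σ := σ) (R := K)
          (∏ o, ((f (I o)).toMvPowerSeries o : MvPowerSeries (Option σ) K)) =
        PowerSeries.map (algebraMap K B) (f (I none)) * PowerSeries.C (G (I ∘ some)) := by
    intro I
    rw [map_prod (optionEquivLeft (σ := σ) (R := K)), Fintype.prod_option,
      optionEquivLeft_toMvPowerSeries_none, hCalg]
    simp only [optionEquivLeft_toMvPowerSeries_some]
    rw [← map_prod (PowerSeries.C (R := B))]
    rfl
  have hΦrel : ∑ I : Option σ → ι, Polynomial.aeval b (ψ (Q I)) *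
      (PowerSeries.map (algebraMap K B) (f (I none)) * PowerSeries.C (G (I ∘ some))) = 0 := by
    have h := congrArg (optionEquivLeft (σ := σ) (R := K)) hrel
    rw [map_zero, map_sum] at h
    refine Eq.trans (sum_congr rfl fun I _ ↦ ?_) h
    rw [map_mul (optionEquivLeft (σ := σ) (R := K)), optionEquivLeft_aeval p (Q I), hprod I, hψ,
      hb, ← hCalg]
  -- (2) regroup by the value `𝐢 none`
  set Rpoly : ι → Polynomial B := fun i ↦
    ∑ J : σ → ι, Polynomial.C (G J) * ψ (Q (e.symm (i, J))) with hR
  have hidx : ∀ I : Option σ → ι,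
      Polynomial.aeval b (ψ (Q I)) *
        (PowerSeries.map (algebraMap K B) (f (I none)) * PowerSeries.C (G (I ∘ some))) =
      (fun q : ι × (σ → ι) ↦ Polynomial.aeval b (ψ (Q (e.symm q))) *
        (PowerSeries.map (algebraMap K B) (f q.1) * PowerSeries.C (G q.2))) (e I) := by
    intro I
    simp only [he, Equiv.symm_apply_apply]
    rfl
  have hre : ∑ I : Option σ → ι, Polynomial.aeval b (ψ (Q I)) *
      (PowerSeries.map (algebraMap K B) (f (I none)) * PowerSeries.C (G (I ∘ some))) =
      ∑ i, Polynomial.aeval b (Rpoly i) * PowerSeries.map (algebraMap K B) (f i) := by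
    rw [Fintype.sum_equiv e _ (fun q : ι × (σ → ι) ↦ Polynomial.aeval b (ψ (Q (e.symm q))) *
        (PowerSeries.map (algebraMap K B) (f q.1) * PowerSeries.C (G q.2))) hidx,
      Fintype.sum_prod_type]
    refine sum_congr rfl fun i _ ↦ ?_
    rw [hR]
    dsimp only
    rw [map_sum (Polynomial.aeval b), sum_mul]
    refine sum_congr rfl fun J _ ↦ ?_
    rw [map_mul (Polynomial.aeval b), Polynomial.aeval_C, ← PowerSeries.C_eq_algebraMap]
    ring
  have hRrel : ∑ i, Polynomial.aeval b (Rpoly i) * PowerSeries.map (algebraMap K B) (f i) = 0 := by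
    rw [← hre]; exact hΦrel
  -- (3) the one-variable base-change lemma kills every `Rpoly i`
  have hR0 : ∀ i, Rpoly i = 0 :=
    Literature.RingTheory.PowerSeries.linearIndependent_aeval_baseChange f p hind Rpoly hRrel
  -- (4) coefficients of `Rpoly i` are relations in the `σ` variables: the induction hypothesis
  have hcoef : ∀ i k, ∀ J : σ → ι,
      (MvPolynomial.optionEquivLeft K σ (Q (e.symm (i, J)))).coeff k = 0 := by
    intro i k
    apply IH (fun J ↦ (MvPolynomial.optionEquivLeft K σ (Q (e.symm (i, J)))).coeff k)
    have h := hR0 i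
    rw [hR] at h
    dsimp only at h
    have hk := congrArg (fun P : Polynomial B ↦ P.coeff k) h
    rw [Polynomial.finsetSum_coeff, Polynomial.coeff_zero] at hk
    refine Eq.trans (sum_congr rfl fun J _ ↦ ?_) hk
    rw [Polynomial.coeff_C_mul, hψ, coeff_aeval_optionElim, hG, mul_comm]
  -- (5) conclude
  intro I
  obtain ⟨⟨i, J⟩, rfl⟩ := e.symm.surjective I
  apply (MvPolynomial.optionEquivLeft K σ).injective
  rw [map_zero]
  exact Polynomial.ext fun k ↦ (hcoef i k J).trans (Polynomial.coeff_zero k).symm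

end optionStep

/-! ### 3. Transport along a bijection of the variables, the empty case, and the theorem -/

section transport

/-- Transport of the independence property along a bijection of variable sets. [folklore] -/
theorem productFamily_independent_of_equiv {α β : Type*} [Fintype α] [DecidableEq α] [Fintype β]
    [DecidableEq β] (eq : α ≃ β) (f : ι → PowerSeries K) (p : PowerSeries K)
    (Hα : ∀ Q : (α → ι) → MvPolynomial α K,
      ∑ J : α → ι, MvPolynomial.aeval (fun s : α ↦ (p.toMvPowerSeries s : MvPowerSeries α K))
        (Q J) * ∏ s, ((f (J s)).toMvPowerSeries s : MvPowerSeries α K) = 0 → ∀ J, Q J = 0)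
    (Q : (β → ι) → MvPolynomial β K)
    (hrel : ∑ I : β → ι, MvPolynomial.aeval (fun t : β ↦ (p.toMvPowerSeries t : MvPowerSeries β K))
        (Q I) * ∏ t, ((f (I t)).toMvPowerSeries t : MvPowerSeries β K) = 0) :
    ∀ I, Q I = 0 := by
  classical
  -- index functions: `𝐣 : α → ι` ↦ `𝐣 ∘ eq.symm : β → ι`
  set E : (α → ι) ≃ (β → ι) := eq.arrowCongr (Equiv.refl ι) with hE
  have hE' : ∀ (J : α → ι) (t : β), E J t = J (eq.symm t) := fun J t ↦ by simp [hE]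
  set Qα : (α → ι) → MvPolynomial α K := fun J ↦ MvPolynomial.rename eq.symm (Q (E J)) with hQα
  -- pull the relation back to `α` variables with `rename eq.symm`
  have hrelα : ∑ J : α → ι, MvPolynomial.aeval (fun s : α ↦ (p.toMvPowerSeries s : MvPowerSeries α K))
      (Qα J) * ∏ s, ((f (J s)).toMvPowerSeries s : MvPowerSeries α K) = 0 := by
    have h := congrArg (MvPowerSeries.rename (R := K) eq.symm) hrel
    rw [map_zero, map_sum] at h
    refine Eq.trans (Fintype.sum_equiv E _ _ fun J ↦ ?_) h
    rw [map_mul, map_prod, hQα]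
    congr 1
    · -- coefficients
      simp only []
      rw [MvPolynomial.aeval_rename, ← AlgHom.comp_apply, MvPolynomial.comp_aeval]
      have hfun : ((fun s : α ↦ (p.toMvPowerSeries s : MvPowerSeries α K)) ∘ ⇑eq.symm) =
          fun t : β ↦ MvPowerSeries.rename eq.symm (p.toMvPowerSeries t : MvPowerSeries β K) := by
        funext t
        rw [Function.comp_apply, MvPowerSeries.rename_toMvPowerSeries]
      rw [hfun]
    · -- products
      refine Fintype.prod_equiv eq _ _ fun s ↦ ?_
      rw [MvPowerSeries.rename_toMvPowerSeries, Equiv.symm_apply_apply, hE', Equiv.symm_apply_apply]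
  have hQα0 := Hα Qα hrelα
  intro I
  have h := hQα0 (E.symm I)
  rw [hQα] at h
  simp only [Equiv.apply_symm_apply] at h
  exact MvPolynomial.rename_injective _ eq.symm.injective (by rw [h, map_zero])

/-- The case of no variables: `K⟦x_∅⟧ = K`, the only product is `1`, and a relation `Q · 1 = 0`
forces `Q = 0`. [folklore] -/
theorem productFamily_independent_of_isEmpty {α : Type*} [Fintype α] [DecidableEq α] [IsEmpty α]
    (f : ι → PowerSeries K) (p : PowerSeries K) (Q : (α → ι) → MvPolynomial α K)
    (hrel : ∑ J : α → ι, MvPolynomial.aeval (fun s : α ↦ (p.toMvPowerSeries s : MvPowerSeries α K))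
        (Q J) * ∏ s, ((f (J s)).toMvPowerSeries s : MvPowerSeries α K) = 0) :
    ∀ J, Q J = 0 := by
  haveI : Unique (α → ι) := Pi.uniqueOfIsEmpty _
  rw [Fintype.sum_unique, Fintype.prod_empty, mul_one] at hrel
  intro J
  rw [Subsingleton.elim J default]
  set c : K := MvPolynomial.coeff 0 (Q default) with hc
  have hQ : Q default = MvPolynomial.C c := MvPolynomial.eq_C_of_isEmpty (Q default)
  rw [hQ, MvPolynomial.aeval_C] at hrel
  have h0 : c = 0 := by
    have h1 : (MvPowerSeries.C c : MvPowerSeries α K) = MvPowerSeries.C 0 := by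
      rw [map_zero]; exact hrel
    exact (MvPowerSeries.C_inj _ _).mp h1
  rw [hQ, h0, map_zero]

end transport

/-- **Linear independence of the products `∏_s f_{𝐢 s}(x_s)` over `K[p(x_s) : s]`** (CDT §2.1,
"an easy induction argument on the dimension `d`"), for an arbitrary finite set of variables `σ`:
if `f : ι → K⟦T⟧` and `p ∈ K⟦T⟧` admit no nontrivial relation `∑_i Q_i(p) f_i = 0` with
`Q_i ∈ K[X]`, then the products `∏_{s ∈ σ} f_{𝐢 s}(x_s)`, `𝐢 : σ → ι`, admit no nontrivial
relation `∑_𝐢 Q_𝐢((p(x_s))_s) ∏_s f_{𝐢 s}(x_s) = 0` with `Q_𝐢 ∈ K[X_σ]`.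
[cite: CalegariDimitrovTang2025, §2.1, end of the proof of Lemma 2.1.1] -/
theorem productFamily_independent (f : ι → PowerSeries K) (p : PowerSeries K)
    (hind : ∀ Q : ι → Polynomial K, ∑ i, Polynomial.aeval p (Q i) * f i = 0 → ∀ i, Q i = 0)
    (σ : Type*) [Fintype σ] [DecidableEq σ] (Q : (σ → ι) → MvPolynomial σ K)
    (hrel : ∑ I : σ → ι, MvPolynomial.aeval (fun s : σ ↦ (p.toMvPowerSeries s : MvPowerSeries σ K))
        (Q I) * ∏ s, ((f (I s)).toMvPowerSeries s : MvPowerSeries σ K) = 0) :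
    ∀ I, Q I = 0 := by
  classical
  -- the property (with classical instances), for every finite type, by `induction_empty_option`
  let P : ∀ (α : Type _) [Fintype α], Prop := fun α _ ↦
    ∀ Q : (α → ι) → MvPolynomial α K,
      ∑ J : α → ι, MvPolynomial.aeval (fun s : α ↦ (p.toMvPowerSeries s : MvPowerSeries α K))
        (Q J) * ∏ s, ((f (J s)).toMvPowerSeries s : MvPowerSeries α K) = 0 → ∀ J, Q J = 0
  have hP : P σ := by
    refine Fintype.induction_empty_option (P := P) ?_ ?_ ?_ σ
    · intro α β _ eq Hα
      letI : Fintype α := Fintype.ofEquiv β eq.symm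
      intro Qβ hrelβ
      exact productFamily_independent_of_equiv eq f p (fun Q' h' ↦ Hα Q' (by convert h'))
        Qβ (by convert hrelβ)
    · intro Q h
      exact productFamily_independent_of_isEmpty f p Q (by convert h)
    · intro α _ Hα Q h
      exact productFamily_independent_option f p hind (fun Q' h' ↦ Hα Q' (by convert h'))
        Q (by convert h)
  exact hP Q (by convert hrel)

/-- The `d`-variable form used by CDT (`σ = Fin d`, `𝐢 ∈ {1, …, m}^d`).
[cite: CalegariDimitrovTang2025, §2.1, end of the proof of Lemma 2.1.1] -/
theorem productFamily_independent_fin (f : ι → PowerSeries K) (p : PowerSeries K)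
    (hind : ∀ Q : ι → Polynomial K, ∑ i, Polynomial.aeval p (Q i) * f i = 0 → ∀ i, Q i = 0)
    (d : ℕ) (Q : (Fin d → ι) → MvPolynomial (Fin d) K)
    (hrel : ∑ I : Fin d → ι,
      MvPolynomial.aeval (fun s : Fin d ↦ (p.toMvPowerSeries s : MvPowerSeries (Fin d) K)) (Q I) *
        ∏ s, ((f (I s)).toMvPowerSeries s : MvPowerSeries (Fin d) K) = 0) :
    ∀ I, Q I = 0 :=
  productFamily_independent f p hind (Fin d) Q hrel

end Literature.RingTheory.MvPowerSeries
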